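import Summits.Ventures.PercRepro.S1TriangleVCount
import Summits.Ventures.PercRepro.S1FourCircuitW
import Summits.Ventures.PercRepro.S1FiveCircuitX
import Summits.Ventures.PercRepro.S1CellCaps5

/-!
# PercRepro — the cells `(8, 24)` and `(8, 23)` of the `q = 4` window, by LEMMAS V, W and X (p2, gen 18)

Three bounds in the size `n` of the ground set — LEMMA V's `s₃ ≤ ⌊n²/9⌋`, LEMMA W's `s₄ ≤ ⌊n(n−1)(n−2)/8⌋` and
LEMMA X's `s₅ ≤ ⌊n(n−1)(n−2)(n−3)/20⌋` — make the three-cap cell inequality `cellOK14` hold at `(8, 24)` (`n = 32`: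
`113 / 3720 / 43152`; twin ratio `0.8819`) and at `(8, 23)` (`n = 31`: `106 / 3371 / 37758`; `0.9927`), so the
`e`-free cores of rank `8` with `32` and with `31` points satisfy `RLS` at level `4`. The five-circuit cap is what
moves: the chain's `C(d + 4, 5)` is `98280` / `80730` against LEMMA X's `43152` / `37758`.

* `cell_eight_twentyfour_vwx`, `cell_eight_twentythree_vwx` — the kernel cells;
* **`c025_core_eight_twentyfour`**, **`c025_core_eight_twentythree`** — the cores.
Axioms: standard.
-/

open scoped Matroid

namespace PercRepro

namespace S1

open Set

variable {α : Type}

/-- The cell `(8, 24)` with `s₃ ≤ 113`, `s₄ ≤ 3720`, `s₅ ≤ 43152` (LEMMAS V, W, X at `n = 32`). -/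
theorem cell_eight_twentyfour_vwx : cellOK14 8 24 113 3720 43152 = true := by decide +kernel

/-- The cell `(8, 23)` with `s₃ ≤ 106`, `s₄ ≤ 3371`, `s₅ ≤ 37758` (LEMMAS V, W, X at `n = 31`). -/
theorem cell_eight_twentythree_vwx : cellOK14 8 23 106 3371 37758 = true := by decide +kernel

/-- **THE CELL `(8, 24)`**: an `e`-free core of rank `8` with `32` points satisfies `RLS` at level `4`. -/
theorem c025_core_eight_twentyfour (M : Matroid α) [M.Finite] (hR : M.eRank = (8 : ℕ)) (hn : M.E.ncard = 32)
    (hfree : ∀ e ∈ M.E, ∃ A ⊆ M.E \ {e}, e ∉ M.closure A ∧ e ∉ M.closure ((M.E \ {e}) \ A)) :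
    ThmN.RLS M 8 4 := by
  have hP : {C : Set α | M.IsCircuit C ∧ C.ncard = 3}.ncard ≤ 113 := by
    have h := core_ncard_triangles_le_sq_div_nine M hfree
    rw [hn] at h
    exact h.trans (by norm_num)
  have hS : {C : Set α | M.IsCircuit C ∧ C.ncard = 4}.ncard ≤ 3720 := by
    have h := core_ncard_fourCircuits_le_mul_div M hfree
    rw [hn] at h
    exact h.trans (by norm_num)
  have hS5 : {C : Set α | M.IsCircuit C ∧ C.ncard = 5}.ncard ≤ 43152 := by
    have h := core_ncard_fiveCircuits_le_mul_div M hfree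
    rw [hn] at h
    exact h.trans (by norm_num)
  exact rls_of_cellOK14 M 8 24 113 3720 43152 (by norm_num) hR hn hfree hP hS hS5 (by norm_num)
    cell_eight_twentyfour_vwx

/-- **THE CELL `(8, 23)`**: an `e`-free core of rank `8` with `31` points satisfies `RLS` at level `4`. -/
theorem c025_core_eight_twentythree (M : Matroid α) [M.Finite] (hR : M.eRank = (8 : ℕ)) (hn : M.E.ncard = 31)
    (hfree : ∀ e ∈ M.E, ∃ A ⊆ M.E \ {e}, e ∉ M.closure A ∧ e ∉ M.closure ((M.E \ {e}) \ A)) :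
    ThmN.RLS M 8 4 := by
  have hP : {C : Set α | M.IsCircuit C ∧ C.ncard = 3}.ncard ≤ 106 := by
    have h := core_ncard_triangles_le_sq_div_nine M hfree
    rw [hn] at h
    exact h.trans (by norm_num)
  have hS : {C : Set α | M.IsCircuit C ∧ C.ncard = 4}.ncard ≤ 3371 := by
    have h := core_ncard_fourCircuits_le_mul_div M hfree
    rw [hn] at h
    exact h.trans (by norm_num)
  have hS5 : {C : Set α | M.IsCircuit C ∧ C.ncard = 5}.ncard ≤ 37758 := by
    have h := core_ncard_fiveCircuits_le_mul_div M hfree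
    rw [hn] at h
    exact h.trans (by norm_num)
  exact rls_of_cellOK14 M 8 23 106 3371 37758 (by norm_num) hR hn hfree hP hS hS5 (by norm_num)
    cell_eight_twentythree_vwx

end S1

end PercRepro
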